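import Summits.CriticalPhenomena.CardyFormulaZ2.Theorems.CardyIKTransportIKLinearTransportWallDominationPlanarDefs

/-!
# `CardyIKTransport.IKLinearTransport` (stmt-CriticalPhenomena-5076), line `pinned-diagram-exchange`, lead c8 wave 3 —
# WALL DOMINATION, planar transfer, CYLINDER SIDE (helpers): black walks of a half-slab read on the band

Support file (`--supports stmt-CriticalPhenomena-5076`) for the registered sub-goal `stub_thinRingCylSubset` (cylinder side of
the planar transfer of thin rings, `ThinRingCylSubset` of `…WallDominationPlanarDefs`).  Slab of `s + s` face columns on the
cylinder of circumference `L = 2M + 7s + 1`; band = rows `[0, 2M+3s)`, read by `CylPlane.bandQ L (2M+3s-1)`; windows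
`[M, M+3s)`; margins `[0, M)` and `[M+3s, 2M+3s)`; off-band `[2M+3s, L)`.  A HALF-SLAB (part) is a configuration
`P : CylCfg s L` whose cells and faces are those of `x : CylCfg (s+s) L` shifted by `o` columns (`o = 0`: left part
`CylBunchStub.resLE`; `o = s`: right part `resGE`).

* §1 `ivt_gen`: DISCRETE INTERMEDIATE VALUES on a cycle `ℤ/N` cut as target `[0,T)` · band `[T,S₁)` · start `[S₁,S₂)` · band
  `[S₂,N)` (the sister line's `CylPlane.ivt` with the four arcs freed): a walk whose row coordinate moves by `0, ±1` cyclically,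
  from the start arc to the target arc, contains a sub-walk inside one of the two bands joining its two extreme rows.
* §2 `cellGraph_adj_of_adj`: a black edge of the band of the slab is an edge of the planar triangulation `cellGraph` of the
  observables `CylPlane.obsQ (bandQ L h x)` (both orientations of `CylPlane.clause_of_rel`).
* §3 `pathIn_of_walk`: a black walk of a part all of whose cells lie in the band rows is a `BlackPathIn` of the observables of
  the band inside the planar image of the part.
* §4 `tb_of_bandReach`, `exit_of_walk`: a black walk of a part from a window row to an off-band row crosses a margin box of
  that part bottom-to-top (`ivt_gen`), which read on the band is `x ∈ ExitCyl s M L`.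
* §5 `cylSubset_link`: THE LINK DICHOTOMY — a black connection of a part between a cell of a window row and any cell is, read
  on the band, a `BlackPathIn` inside the planar image of the part, unless `x ∈ ExitCyl s M L` (registered helper name
  `cylSubset_link`).
-/

noncomputable section

namespace Summit.CriticalPhenomena.CardyFormulaZ2.Theorems.IKLinearTransport.PinnedDiagramExchange.WallDomination

open scoped BigOperators Classical
open Finset
open Literature.Probability.Percolation Literature.Probability.LatticeModels
open Summit.CriticalPhenomena.CardyFormulaZ2.Cruxes.IKMixedBoxCrossing.DefectClosureExploration
open CylPlane (obsQ bandQ bsite bsite_apply bsite_black clause_of_rel blackEdges_of_adj bandReach bandReach_refl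
  bandReach_symm bandReach_cons step_rel val_sub_natCast)
open BridgeLawStub (site site_injective)

namespace ThinRingCylSubsetStub

variable {L : ℕ}

/-! ## §1 Discrete intermediate values on a cycle with four free arcs -/

section IVT

variable {V : Type*} {G : SimpleGraph V} {ν : V → ℕ} {C : Prop}

/-- The inductive invariant of the intermediate value argument on the cycle `ℤ/N` cut as `[0,T)` (target), `[T,S₁)` (band 1),
`[S₁,S₂)` (start), `[S₂,N)` (band 2), for a walk ending in the target arc; `C` is any consequence of a crossing of band 1
between its extreme rows or of band 2 between its extreme rows. -/
theorem ivt_inv {T S₁ S₂ N : ℕ} (hT : T < S₁) (h12 : S₁ < S₂) (h2N : S₂ < N) (hν : ∀ z, ν z < N)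
    (hstep : ∀ p q, G.Adj p q → ν q = ν p ∨ ν q = ν p + 1 ∨ (ν p + 1 = N ∧ ν q = 0) ∨ ν p = ν q + 1 ∨
      (ν q + 1 = N ∧ ν p = 0))
    (hC₁ : ∀ a b, ν a = T → ν b + 1 = S₁ → (a, b) ∈ bandReach G ν T S₁ → C)
    (hC₂ : ∀ a b, ν a = S₂ → ν b + 1 = N → (a, b) ∈ bandReach G ν S₂ N → C)
    {s u : V} (p : G.Walk s u) (hu : ν u < T) :
    (S₁ ≤ ν s → ν s < S₂ → C) ∧
    (T ≤ ν s → ν s < S₁ → C ∨ ∃ a, ν a = T ∧ (s, a) ∈ bandReach G ν T S₁) ∧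
    (S₂ ≤ ν s → C ∨ ∃ a, ν a + 1 = N ∧ (s, a) ∈ bandReach G ν S₂ N) := by
  induction p with
  | nil => exact ⟨fun h1 _ => by omega, fun h1 _ => by omega, fun h1 => by omega⟩
  | @cons s s₁ u' hadj p' ih =>
    obtain ⟨ih1, ih2, ih3⟩ := ih hu
    have hs₁ := hν s₁
    have hs := hν s
    refine ⟨fun h1 h2 => ?_, fun h1 h2 => ?_, fun h1 => ?_⟩
    · -- `s` in the start arc `[S₁, S₂)`
      rcases hstep s s₁ hadj with e | e | ⟨e1, e2⟩ | e | ⟨e1, e2⟩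
      · exact ih1 (by omega) (by omega)
      · by_cases h6 : ν s₁ < S₂
        · exact ih1 (by omega) h6
        · rcases ih3 (by omega) with hQ | ⟨a, ha, hr⟩
          · exact hQ
          · exact hC₂ s₁ a (by omega) ha hr
      · omega
      · by_cases h4 : S₁ ≤ ν s₁
        · exact ih1 h4 (by omega)
        · rcases ih2 (by omega) (by omega) with hQ | ⟨a, ha, hr⟩
          · exact hQ
          · exact hC₁ a s₁ ha (by omega) (bandReach_symm hr)
      · omega
    · -- `s` in band 1 `[T, S₁)`
      rcases hstep s s₁ hadj with e | e | ⟨e1, e2⟩ | e | ⟨e1, e2⟩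
      · rcases ih2 (by omega) (by omega) with hQ | ⟨a, ha, hr⟩
        · exact Or.inl hQ
        · exact Or.inr ⟨a, ha, bandReach_cons hadj ⟨h1, h2⟩ hr⟩
      · by_cases h4 : ν s₁ < S₁
        · rcases ih2 (by omega) h4 with hQ | ⟨a, ha, hr⟩
          · exact Or.inl hQ
          · exact Or.inr ⟨a, ha, bandReach_cons hadj ⟨h1, h2⟩ hr⟩
        · exact Or.inl (ih1 (by omega) (by omega))
      · omega
      · by_cases h3 : T ≤ ν s₁
        · rcases ih2 h3 (by omega) with hQ | ⟨a, ha, hr⟩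
          · exact Or.inl hQ
          · exact Or.inr ⟨a, ha, bandReach_cons hadj ⟨h1, h2⟩ hr⟩
        · exact Or.inr ⟨s, by omega, bandReach_refl ⟨h1, h2⟩⟩
      · omega
    · -- `s` in band 2 `[S₂, N)`
      rcases hstep s s₁ hadj with e | e | ⟨e1, e2⟩ | e | ⟨e1, e2⟩
      · rcases ih3 (by omega) with hQ | ⟨a, ha, hr⟩
        · exact Or.inl hQ
        · exact Or.inr ⟨a, ha, bandReach_cons hadj ⟨h1, hs⟩ hr⟩
      · rcases ih3 (by omega) with hQ | ⟨a, ha, hr⟩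
        · exact Or.inl hQ
        · exact Or.inr ⟨a, ha, bandReach_cons hadj ⟨h1, hs⟩ hr⟩
      · exact Or.inr ⟨s, by omega, bandReach_refl ⟨h1, hs⟩⟩
      · by_cases h6 : S₂ ≤ ν s₁
        · rcases ih3 h6 with hQ | ⟨a, ha, hr⟩
          · exact Or.inl hQ
          · exact Or.inr ⟨a, ha, bandReach_cons hadj ⟨h1, hs⟩ hr⟩
        · exact Or.inl (ih1 (by omega) (by omega))
      · omega

/-- **Discrete intermediate values on a cycle, four free arcs**: a walk from the start arc `[S₁, S₂)` to the target arc
`[0, T)` whose coordinate moves by `0, ±1` cyclically crosses band 1 `[T, S₁)` or band 2 `[S₂, N)` between their extreme rows. -/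
theorem ivt_gen {T S₁ S₂ N : ℕ} (hT : T < S₁) (h12 : S₁ < S₂) (h2N : S₂ < N) (hν : ∀ z, ν z < N)
    (hstep : ∀ p q, G.Adj p q → ν q = ν p ∨ ν q = ν p + 1 ∨ (ν p + 1 = N ∧ ν q = 0) ∨ ν p = ν q + 1 ∨
      (ν q + 1 = N ∧ ν p = 0))
    (hC₁ : ∀ a b, ν a = T → ν b + 1 = S₁ → (a, b) ∈ bandReach G ν T S₁ → C)
    (hC₂ : ∀ a b, ν a = S₂ → ν b + 1 = N → (a, b) ∈ bandReach G ν S₂ N → C)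
    {s u : V} (p : G.Walk s u) (hu : ν u < T) (hs : S₁ ≤ ν s ∧ ν s < S₂) : C :=
  (ivt_inv hT h12 h2N hν hstep hC₁ hC₂ p hu).1 hs.1 hs.2

end IVT

/-! ## §2 Black edges of the band are edges of the planar triangulation of the band observables -/

/-- A black edge of the band of the slab is, read through `CylPlane.bsite`, an edge of the triangulation `cellGraph` of the
observables of the band (`CylPlane.clause_of_rel` in both orientations; `h + 1 < L` keeps the band from wrapping around). -/
theorem cellGraph_adj_of_adj {w h : ℕ} [NeZero L] (y : CylCfg w L) (hL : h + 1 < L) (z z' : Fin (w + 1) × ZMod L)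
    (hz : y.1 z = true ∧ z.2.val < h + 1) (hz' : y.1 z' = true ∧ z'.2.val < h + 1) (hadj : (cylGraph w L y.2).Adj z z') :
    (cellGraph (obsQ (bandQ L h y)).2).Adj (bsite z hz.2) (bsite z' hz'.2) := by
  rw [cylGraph, SimpleGraph.fromRel_adj] at hadj
  obtain ⟨hne, hr⟩ := hadj
  rw [cellGraph, SimpleGraph.fromRel_adj]
  refine ⟨fun heq => hne ?_, hr.imp (fun h' => (clause_of_rel y hL hz hz' h').2.2) (fun h' => (clause_of_rel y hL hz' hz h').2.2)⟩
  have e := site_injective heq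
  simp only [Prod.mk.injEq, Fin.mk.injEq] at e
  exact Prod.ext e.1 (ZMod.val_injective L e.2)

/-! ## §3 Band-confined black walks of a part are planar black paths of the band observables -/

section Part

variable [NeZero L] {s M : ℕ}

/-- A black walk of the part at column offset `o` (cells `(c, r)` of `P` = cells `(o + c, r)` of `x`, likewise faces) all of
whose cells lie in the band rows `[0, 2M+3s)` is, read on the band, a black path of the observables for the planar
triangulation, inside any region `R` containing the planar images `(o + c, r.val)` of the band cells of the part. -/
theorem pathIn_of_walk (hHL : 2 * M + 3 * s < L) (x : CylCfg (s + s) L) (P : CylCfg s L) (o : ℕ)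
    (ho : o + s ≤ s + s) (hP1 : ∀ z : Fin (s + 1) × ZMod L, P.1 z = x.1 (⟨o + z.1.val, by omega⟩, z.2))
    (hP2 : ∀ f : Fin s × ZMod L, P.2 f = x.2 (⟨o + f.1.val, by omega⟩, f.2)) (R : Set (Site 2))
    (hR : ∀ z : Fin (s + 1) × ZMod L, z.2.val < 2 * M + 3 * s →
      (![((o + z.1.val : ℕ) : ℤ), ((z.2.val : ℕ) : ℤ)] : Site 2) ∈ R)
    {a b : {z : Fin (s + 1) × ZMod L // P.1 z = true}}
    (p : ((cylGraph s L P.2).induce {z | P.1 z = true}).Walk a b)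
    (hp : ∀ z ∈ p.support, z.1.2.val < 2 * M + 3 * s) :
    BlackPathIn (obsQ (bandQ L (2 * M + 3 * s - 1) x)) R
      ![((o + a.1.1.val : ℕ) : ℤ), ((a.1.2.val : ℕ) : ℤ)] ![((o + b.1.1.val : ℕ) : ℤ), ((b.1.2.val : ℕ) : ℤ)] := by
  -- the planar image of a band cell of the part is a black cell of the band observables inside `R`
  have hband : ∀ z : {z : Fin (s + 1) × ZMod L // P.1 z = true}, z.1.2.val < 2 * M + 3 * s →
      x.1 ((⟨o + z.1.1.val, by omega⟩, z.1.2) : Fin (s + s + 1) × ZMod L) = true ∧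
        ((⟨o + z.1.1.val, by omega⟩, z.1.2) : Fin (s + s + 1) × ZMod L).2.val < 2 * M + 3 * s - 1 + 1 :=
    fun z hz => ⟨by rw [← hP1]; exact z.2, by show z.1.2.val < _; omega⟩
  have hsite : ∀ (z : {z : Fin (s + 1) × ZMod L // P.1 z = true}) (hz : z.1.2.val < 2 * M + 3 * s),
      bsite _ (hband z hz).2 = (![((o + z.1.1.val : ℕ) : ℤ), ((z.1.2.val : ℕ) : ℤ)] : Site 2) := fun z hz => rfl
  have hF : ∀ z : {z : Fin (s + 1) × ZMod L // P.1 z = true}, z.1.2.val < 2 * M + 3 * s →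
      (![((o + z.1.1.val : ℕ) : ℤ), ((z.1.2.val : ℕ) : ℤ)] : Site 2) ∈ (obsQ (bandQ L (2 * M + 3 * s - 1) x)).1 ∧
        (![((o + z.1.1.val : ℕ) : ℤ), ((z.1.2.val : ℕ) : ℤ)] : Site 2) ∈ R :=
    fun z hz => ⟨hsite z hz ▸ bsite_black x (hband z hz), hR z.1 hz⟩
  -- a black edge of the part inside the band is an edge of the planar triangulation of the band observables
  have hA : ∀ z z' : {z : Fin (s + 1) × ZMod L // P.1 z = true}, (hz : z.1.2.val < 2 * M + 3 * s) →
      (hz' : z'.1.2.val < 2 * M + 3 * s) → ((cylGraph s L P.2).induce {z | P.1 z = true}).Adj z z' →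
      (cellGraph (obsQ (bandQ L (2 * M + 3 * s - 1) x)).2).Adj
        ![((o + z.1.1.val : ℕ) : ℤ), ((z.1.2.val : ℕ) : ℤ)] ![((o + z'.1.1.val : ℕ) : ℤ), ((z'.1.2.val : ℕ) : ℤ)] := by
    intro z z' hz hz' hadj
    have hadj' : (cylGraph s L P.2).Adj z.1 z'.1 := hadj
    rw [← hsite z hz, ← hsite z' hz']
    exact cellGraph_adj_of_adj x (by omega) _ _ (hband z hz) (hband z' hz')
      ((SlabDetStub.adj_shift (flg := x.2) (flg' := P.2) (i := o) (fun j r h => (hP2 (j, r)).symm)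
        rfl rfl rfl rfl).2 hadj')
  induction p with
  | nil =>
    rename_i a
    refine ⟨[![((o + a.1.1.val : ℕ) : ℤ), ((a.1.2.val : ℕ) : ℤ)]], List.isChain_singleton _, rfl, rfl, fun v hv => ?_⟩
    rw [List.mem_singleton] at hv
    rw [hv]
    exact hF a (hp a (SimpleGraph.Walk.start_mem_support _))
  | @cons a a' b hadj p' ih =>
    have ha := hp a (SimpleGraph.Walk.start_mem_support _)
    have hp' : ∀ z ∈ p'.support, z.1.2.val < 2 * M + 3 * s := fun z hz =>
      hp z (List.mem_cons_of_mem _ hz)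
    obtain ⟨l, hl, hh, hg, hm⟩ := ih hp'
    refine ⟨![((o + a.1.1.val : ℕ) : ℤ), ((a.1.2.val : ℕ) : ℤ)] :: l, hl.cons fun y hy => ?_, rfl, ?_, fun v hv => ?_⟩
    · rw [hh, Option.mem_def, Option.some.injEq] at hy
      rw [← hy]
      exact hA a a' ha (hp' a' (SimpleGraph.Walk.start_mem_support _)) hadj
    · obtain ⟨y, l', rfl⟩ : ∃ y l', l = y :: l' := by
        cases l with
        | nil => exact absurd hh (by simp)
        | cons y l' => exact ⟨y, l', rfl⟩
      rw [List.getLast?_cons_cons]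
      exact hg
    · rcases List.mem_cons.1 hv with hv | hv
      · rw [hv]; exact hF a ha
      · exact hm v hv

/-! ## §4 Black walks of a part leaving the band from a window cross a margin box -/

/-- A walk of black cells of the part at column offset `o` inside the coordinate band `lo ≤ ν < hi = lo + M`, on which the row
is `cy + (ν - lo)` with `cy + M ≤ 2M + 3s`, from a cell with `ν = lo` to a cell with `ν = hi - 1` is, read on the band, a black
bottom–top crossing of the planar box `[o, o+s] × [cy, cy+M)` of the band observables (`CylPlane.blackEdges_of_adj`). -/
theorem tb_of_bandReach (hHL : 2 * M + 3 * s < L) (x : CylCfg (s + s) L) (P : CylCfg s L) (o : ℕ)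
    (ho : o + s ≤ s + s) (hP1 : ∀ z : Fin (s + 1) × ZMod L, P.1 z = x.1 (⟨o + z.1.val, by omega⟩, z.2))
    (hP2 : ∀ f : Fin s × ZMod L, P.2 f = x.2 (⟨o + f.1.val, by omega⟩, f.2))
    (ν : {z : Fin (s + 1) × ZMod L // P.1 z = true} → ℕ) (cy lo hi : ℕ) (hhi : hi = lo + M)
    (hcy : cy + M ≤ 2 * M + 3 * s)
    (hrow : ∀ z : {z : Fin (s + 1) × ZMod L // P.1 z = true}, lo ≤ ν z → ν z < hi → z.1.2.val = cy + (ν z - lo))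
    {a b : {z : Fin (s + 1) × ZMod L // P.1 z = true}} (ha : ν a = lo) (hb : ν b + 1 = hi)
    (hr : (a, b) ∈ bandReach ((cylGraph s L P.2).induce {z | P.1 z = true}) ν lo hi) :
    obsQ (bandQ L (2 * M + 3 * s - 1) x) ∈ tbCross (o : ℤ) (cy : ℤ) (s + 1) M := by
  obtain ⟨ha', hb', hreach⟩ := hr
  have hband : ∀ z : {z : Fin (s + 1) × ZMod L // P.1 z = true}, lo ≤ ν z ∧ ν z < hi →
      x.1 ((⟨o + z.1.1.val, by omega⟩, z.1.2) : Fin (s + s + 1) × ZMod L) = true ∧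
        ((⟨o + z.1.1.val, by omega⟩, z.1.2) : Fin (s + s + 1) × ZMod L).2.val < 2 * M + 3 * s - 1 + 1 :=
    fun z hz => ⟨by rw [← hP1]; exact z.2, by have := hrow z hz.1 hz.2; show z.1.2.val < _; omega⟩
  let ψ : (((cylGraph s L P.2).induce {z | P.1 z = true}).induce {z | lo ≤ ν z ∧ ν z < hi}) →g
      ((openGraph (blackEdges (obsQ (bandQ L (2 * M + 3 * s - 1) x)))).induce
        {v : Site 2 | (o : ℤ) ≤ v 0 ∧ v 0 < (o : ℤ) + ((s + 1 : ℕ) : ℤ) ∧ (cy : ℤ) ≤ v 1 ∧ v 1 < (cy : ℤ) + (M : ℤ)}) :=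
    { toFun := fun z => ⟨bsite _ (hband z.1 z.2).2, by
        have h0 := bsite_apply _ (hband z.1 z.2).2
        have hr := hrow z.1 z.2.1 z.2.2
        have hz2 := z.2.2
        have hc := z.1.1.1.isLt
        refine ⟨?_, ?_, ?_, ?_⟩ <;> simp only [h0.1, h0.2, Set.mem_setOf_eq] <;> push_cast <;> omega⟩
      map_rel' := fun {z z'} hzz' => by
        have hadj : (cylGraph s L P.2).Adj z.1.1 z'.1.1 := hzz'
        exact blackEdges_of_adj x (by omega) (hband z.1 z.2) (hband z'.1 z'.2)
          ((SlabDetStub.adj_shift (flg := x.2) (flg' := P.2) (i := o) (fun j r h => (hP2 (j, r)).symm)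
            rfl rfl rfl rfl).2 hadj) }
  have h0a := bsite_apply _ (hband a ha').2
  have h0b := bsite_apply _ (hband b hb').2
  have hra := hrow a ha'.1 ha'.2
  have hrb := hrow b hb'.1 hb'.2
  have hca := a.1.1.isLt
  have hcb := b.1.1.isLt
  refine ⟨bsite _ (hband a ha').2, ⟨?_, ?_, ?_⟩, bsite _ (hband b hb').2, ⟨?_, ?_, ?_⟩, (ψ ⟨a, ha'⟩).2, (ψ ⟨b, hb'⟩).2,
    hreach.map ψ⟩ <;> simp only [h0a.1, h0a.2, h0b.1, h0b.2] <;> push_cast <;> omega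

/-- **Exit**: on the slab of circumference `L = 2M + 7s + 1`, `M ≥ 1`, a black walk of the part at column offset `o` from a cell
of a window row `[M, M+3s)` to a cell of an off-band row `[2M+3s, L)` crosses the bottom margin box `[o, o+s] × [0, M)` or the top
margin box `[o, o+s] × [M+3s, 2M+3s)` of the part bottom-to-top (`ivt_gen` for the row counted from `2M + 3s`), so that — these
being the margin boxes `ib`, `it` of `marginCorner` — `x ∈ ExitCyl s M L`. -/
theorem exit_of_walk (hs : 1 ≤ s) (hM : 1 ≤ M) (hL : L = 2 * M + 7 * s + 1) (x : CylCfg (s + s) L) (P : CylCfg s L)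
    (o : ℕ) (ho : o + s ≤ s + s) (hP1 : ∀ z : Fin (s + 1) × ZMod L, P.1 z = x.1 (⟨o + z.1.val, by omega⟩, z.2))
    (hP2 : ∀ f : Fin s × ZMod L, P.2 f = x.2 (⟨o + f.1.val, by omega⟩, f.2)) (ib it : Fin 4)
    (hib : marginCorner s M ib = ((o : ℤ), ((0 : ℕ) : ℤ))) (hit : marginCorner s M it = ((o : ℤ), ((M + 3 * s : ℕ) : ℤ)))
    {a b : {z : Fin (s + 1) × ZMod L // P.1 z = true}} (p : ((cylGraph s L P.2).induce {z | P.1 z = true}).Walk a b)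
    (ha : M ≤ a.1.2.val ∧ a.1.2.val < M + 3 * s) (hb : 2 * M + 3 * s ≤ b.1.2.val) : x ∈ ExitCyl s M L := by
  -- the row counted from the first off-band row
  have hconv : ∀ r : ZMod L, (2 * M + 3 * s ≤ r.val → (r - ((2 * M + 3 * s : ℕ) : ZMod L)).val = r.val - (2 * M + 3 * s)) ∧
      (r.val < 2 * M + 3 * s → (r - ((2 * M + 3 * s : ℕ) : ZMod L)).val = r.val + (4 * s + 1)) := fun r =>
    ⟨fun h => val_sub_natCast r _ h, fun h => by
      have e : r - ((2 * M + 3 * s : ℕ) : ZMod L) = r + ((4 * s + 1 : ℕ) : ZMod L) := by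
        rw [sub_eq_iff_eq_add, add_assoc, ← Nat.cast_add, show 4 * s + 1 + (2 * M + 3 * s) = L by omega,
          ZMod.natCast_self, add_zero]
      have h4 : ((4 * s + 1 : ℕ) : ZMod L).val = 4 * s + 1 := ZMod.val_cast_of_lt (by omega)
      rw [e, ZMod.val_add_of_lt (by rw [h4]; omega), h4]⟩
  have hrL : ∀ r : ZMod L, r.val < L := fun r => ZMod.val_lt r
  have hHL : 2 * M + 3 * s < L := by omega
  refine ivt_gen (G := (cylGraph s L P.2).induce {z | P.1 z = true})
    (ν := fun z => (z.1.2 - ((2 * M + 3 * s : ℕ) : ZMod L)).val) (C := x ∈ ExitCyl s M L)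
    (T := 4 * s + 1) (S₁ := 4 * s + 1 + M) (S₂ := 7 * s + 1 + M) (N := L) (by omega) (by omega) (by omega)
    (fun z => ZMod.val_lt _) (fun p q hpq => step_rel P _ p q hpq) (fun a' b' ha' hb' hr => ?_) (fun a' b' ha' hb' hr => ?_)
    p ?_ ?_
  · -- crossing of the bottom margin `[0, M)` of the part
    refine Set.mem_iUnion.2 ⟨ib, ?_⟩
    show obsQ (bandQ L (2 * M + 3 * s - 1) x) ∈ tbCross (marginCorner s M ib).1 (marginCorner s M ib).2 (s + 1) M
    rw [hib]
    refine tb_of_bandReach hHL x P o ho hP1 hP2 _ 0 (4 * s + 1) (4 * s + 1 + M) rfl (by omega) (fun z h1 h2 => ?_) ha'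
      (by omega) hr
    have hz := hrL z.1.2
    rcases Nat.lt_or_ge z.1.2.val (2 * M + 3 * s) with h | h
    · rw [(hconv z.1.2).2 h] at h1 h2 ⊢; omega
    · rw [(hconv z.1.2).1 h] at h1; omega
  · -- crossing of the top margin `[M+3s, 2M+3s)` of the part
    refine Set.mem_iUnion.2 ⟨it, ?_⟩
    show obsQ (bandQ L (2 * M + 3 * s - 1) x) ∈ tbCross (marginCorner s M it).1 (marginCorner s M it).2 (s + 1) M
    rw [hit]
    refine tb_of_bandReach hHL x P o ho hP1 hP2 _ (M + 3 * s) (7 * s + 1 + M) L (by omega) (by omega)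
      (fun z h1 h2 => ?_) ha' hb' hr
    rcases Nat.lt_or_ge z.1.2.val (2 * M + 3 * s) with h | h
    · rw [(hconv z.1.2).2 h] at h1 ⊢; omega
    · have hz := hrL z.1.2
      rw [(hconv z.1.2).1 h] at h1; omega
  · -- the end cell is off the band
    show (b.1.2 - ((2 * M + 3 * s : ℕ) : ZMod L)).val < 4 * s + 1
    have hz := hrL b.1.2
    rw [(hconv b.1.2).1 hb]; omega
  · -- the start cell is in a window
    show 4 * s + 1 + M ≤ (a.1.2 - ((2 * M + 3 * s : ℕ) : ZMod L)).val ∧ (a.1.2 - ((2 * M + 3 * s : ℕ) : ZMod L)).val < 7 * s + 1 + M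
    rw [(hconv a.1.2).2 (by omega)]; omega

/-! ## §5 The link dichotomy -/

/-- THE LINK DICHOTOMY for the part at column offset `o`: a black connection of the part from a cell `c` of a window row
`[M, M+3s)` to a cell `d` is, read on the band, a black path of the band observables inside `R` between the planar images of
`c` and `d` — or one of its realising walks leaves the band and `x ∈ ExitCyl s M L` (`exit_of_walk`). -/
theorem link_of_blackConn (hs : 1 ≤ s) (hM : 1 ≤ M) (hL : L = 2 * M + 7 * s + 1) (x : CylCfg (s + s) L) (P : CylCfg s L)
    (o : ℕ) (ho : o + s ≤ s + s) (hP1 : ∀ z : Fin (s + 1) × ZMod L, P.1 z = x.1 (⟨o + z.1.val, by omega⟩, z.2))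
    (hP2 : ∀ f : Fin s × ZMod L, P.2 f = x.2 (⟨o + f.1.val, by omega⟩, f.2)) (ib it : Fin 4)
    (hib : marginCorner s M ib = ((o : ℤ), ((0 : ℕ) : ℤ))) (hit : marginCorner s M it = ((o : ℤ), ((M + 3 * s : ℕ) : ℤ)))
    (R : Set (Site 2)) (hR : ∀ z : Fin (s + 1) × ZMod L, z.2.val < 2 * M + 3 * s →
      (![((o + z.1.val : ℕ) : ℤ), ((z.2.val : ℕ) : ℤ)] : Site 2) ∈ R)
    {c d : Fin (s + 1) × ZMod L} (hc : M ≤ c.2.val ∧ c.2.val < M + 3 * s) (h : BlackConn P c d) :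
    BlackPathIn (obsQ (bandQ L (2 * M + 3 * s - 1) x)) R ![((o + c.1.val : ℕ) : ℤ), ((c.2.val : ℕ) : ℤ)]
      ![((o + d.1.val : ℕ) : ℤ), ((d.2.val : ℕ) : ℤ)] ∨ x ∈ ExitCyl s M L := by
  obtain ⟨hcb, hdb, hreach⟩ := h
  obtain ⟨p⟩ := hreach
  by_cases hband : ∀ z ∈ p.support, z.1.2.val < 2 * M + 3 * s
  · exact Or.inl (pathIn_of_walk (by omega) x P o ho hP1 hP2 R hR p hband)
  · push Not at hband
    obtain ⟨z, hz, hzH⟩ := hband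
    exact Or.inr (exit_of_walk hs hM hL x P o ho hP1 hP2 ib it hib hit (p.takeUntil z hz) hc hzH)

end Part

end ThinRingCylSubsetStub

open ThinRingCylSubsetStub in
/-- **Registered helper `cylSubset_rightLink`** (stub `stub_thinRingCylSubset`, cylinder side of the planar transfer): on the
slab of `s + s` face columns and circumference `L = 2M + 7s + 1`, `s, M ≥ 1`, a link of the RIGHT profile from a wall row of a
window `[M, M+3s)` is, read on the band, a black path of the band observables inside the right planar region between the two
wall cells — unless the configuration lies in the exit event. -/
theorem cylSubset_rightLink : ∀ (s M L : ℕ) [NeZero L], 1 ≤ s → 1 ≤ M → L = 2 * M + 7 * s + 1 →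
    ∀ (x : CylCfg (s + s) L) (r r' : ZMod L), M ≤ r.val → r.val < M + 3 * s → (r, r') ∈ rightRel s s x →
      BlackPathIn (CylPlane.obsQ (CylPlane.bandQ L (2 * M + 3 * s - 1) x)) (rightRegion 0 0 s M) (wallCell 0 s r.val)
        (wallCell 0 s r'.val) ∨ x ∈ ExitCyl s M L := by
  intro s M L _ hs hM hL x r r' hr1 hr2 h
  have hR : ∀ z : Fin (s + 1) × ZMod L, z.2.val < 2 * M + 3 * s →
      (![((s + z.1.val : ℕ) : ℤ), ((z.2.val : ℕ) : ℤ)] : Site 2) ∈ rightRegion 0 0 s M := fun z hz => by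
    have hc := z.1.isLt
    refine ⟨?_, ?_, ?_, ?_⟩ <;>
      simp only [Matrix.cons_val_zero, Matrix.cons_val_one] <;> push_cast <;> omega
  rcases link_of_blackConn hs hM hL x (resGE s s x) s le_rfl (fun z => rfl) (fun f => rfl) 0 1 (by simp [marginCorner])
    (by simp [marginCorner]) (rightRegion 0 0 s M) hR ⟨hr1, hr2⟩ h with h | h
  · left
    convert h using 1 <;> exact Contour.site_ext (by simp [wallCell]) (by simp [wallCell])
  · exact Or.inr h

open ThinRingCylSubsetStub in
/-- The same for the LEFT profile (left part `CylBunchStub.resLE`, wall column `Fin.last s`, left planar region). -/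
theorem cylSubset_leftLink : ∀ (s M L : ℕ) [NeZero L], 1 ≤ s → 1 ≤ M → L = 2 * M + 7 * s + 1 →
    ∀ (x : CylCfg (s + s) L) (r r' : ZMod L), M ≤ r.val → r.val < M + 3 * s → (r, r') ∈ leftRel s s x →
      BlackPathIn (CylPlane.obsQ (CylPlane.bandQ L (2 * M + 3 * s - 1) x)) (leftRegion 0 0 s M) (wallCell 0 s r.val)
        (wallCell 0 s r'.val) ∨ x ∈ ExitCyl s M L := by
  intro s M L _ hs hM hL x r r' hr1 hr2 h
  have hR : ∀ z : Fin (s + 1) × ZMod L, z.2.val < 2 * M + 3 * s →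
      (![((0 + z.1.val : ℕ) : ℤ), ((z.2.val : ℕ) : ℤ)] : Site 2) ∈ leftRegion 0 0 s M := fun z hz => by
    have hc := z.1.isLt
    refine ⟨?_, ?_, ?_, ?_⟩ <;>
      simp only [Matrix.cons_val_zero, Matrix.cons_val_one] <;> push_cast <;> omega
  rcases link_of_blackConn hs hM hL x (CylBunchStub.resLE (Nat.le_add_right s s) x) 0 (by omega)
    (fun z => congrArg (fun c : Fin (s + s + 1) => x.1 (c, z.2)) (Fin.ext (by simp)))
    (fun f => congrArg (fun c : Fin (s + s) => x.2 (c, f.2)) (Fin.ext (by simp))) 2 3 (by simp [marginCorner])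
    (by simp [marginCorner]) (leftRegion 0 0 s M) hR (c := (Fin.last s, r)) (d := (Fin.last s, r')) ⟨hr1, hr2⟩ h with h | h
  · left
    convert h using 1 <;> exact Contour.site_ext (by simp [wallCell]) (by simp [wallCell])
  · exact Or.inr h


end Summit.CriticalPhenomena.CardyFormulaZ2.Theorems.IKLinearTransport.PinnedDiagramExchange.WallDomination

end
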